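import Summits.BirchSwinnertonDyer.BirchSwinnertonDyer.Theorems.KolyvaginDepthDoorDepthTableRowKitSecondSign
import Summits.BirchSwinnertonDyer.BirchSwinnertonDyer.Theorems.KolyvaginDepthDoorDepthTableGlobalMinimal
import Summits.BirchSwinnertonDyer.BirchSwinnertonDyer.Theorems.KolyvaginDepthDoorDepthTableOddPrimeKit
import Summits.BirchSwinnertonDyer.BirchSwinnertonDyer.Theorems.Rank2ObservatoryKernelPrimes
import Summits.BirchSwinnertonDyer.BirchSwinnertonDyer.Theorems.Rank1ResidualIntModelReduction
import Summits.BirchSwinnertonDyer.Rank1Residual.Additive.PointCountEulerNat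
import Literature.NumberTheory.EllipticCurves.ComplexMultiplicationNotSemistable
import Literature.NumberTheory.EllipticCurves.RationalPointInfiniteOrderCriteria
import Mathlib.Tactic.NormNum.LegendreSymbol
import HarnessLib

/-!
# Route `KolyvaginDepthDoor` — DEPTH-TABLE ROWS ON THE SECOND SIGN, part 3: `53a1` `(7, -47, 167)`, `53a1` `(7, -59, 587)`
# (crux `KolyvaginDepthSupply`, stmt-BirchSwinnertonDyer-21765)

Helper file (`--supports stmt-BirchSwinnertonDyer-21765 --as helper`); it closes nothing and BSD is
not proved by it.

The route's depth table (g2–g9) has rows only on the crux's FIRST rank clause (`ν + 1 = rank E(ℚ)`,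
the 18 rank-2 and 9 rank-3 Cremona curves). This file fills rows on the SECOND clause
`ν = rank E(ℚ) = rank E^{(d_K)}(ℚ) − 1` with `ν = 1`: a RANK-ONE curve `E` and a Heegner field
`K = ℚ(√D)` for `N_E` whose quadratic twist `E^{(D)}` — a RANK-TWO elliptic curve over `ℚ` of conductor
`N_E·D²`, out of reach of every first-sign row through `K` (no Heegner hypothesis for `N_E D²`) — has
two independent rational points. Everything except the bit is decided in the kernel: `E` globally
minimal, non-CM (a multiplicative prime), `ρ̄_{E,p^m}` onto for all `m` (Mazur 6.3 witness + Serre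
Prop. 21 + a transvection), `p` good ordinary, the Heegner condition for `(Δ(E₀), D)`, the Kolyvagin
prime `ℓ` (`(D/ℓ) = −1`, `p ∣ ℓ + 1`, `p ∣ a_ℓ`), `1 ≤ rank_ℤ E(ℚ)` (a rational point with a denominator,
AEC VII.3.4) and `2 ≤ rank_ℤ E^{(D)}(ℚ)` (the tree's rational kernel certificate
`Rank2Observatory.two_le_mordellWeilRank_of_ratCert` on the twist model `[0, D b₂, 0, 8D²b₄, 16D³b₆]`
of the kit `…RowKitSecondSign`: two points found by a naive search, their chord, an odd torsion
annihilator from kernel point counts, doubling witnesses). Each row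
`SecondSign.C<label>.depthRow_<p>_neg<|D|>_<ℓ>_secondSign` takes ANY frame `(Dt, β, ι)` and ANY single
Kolyvagin–Heegner datum `d` of conductor `ℓ`, the ONE named input (γ) =
`GrossLMS1991.prop37_2_frobeniusCongruence` (Gross 1991 Prop. 3.7 (2); cite-only), and concludes from the
bit `d.kolyvaginClass _ 1 ≠ 0`: `corank_{ℤ_p} Ш(E)[p^∞] = 0`, `rank_ℤ E(ℚ) = 1`,
`corank_{ℤ_p} Ш(E^{(D)})[p^∞] = 0`, `rank_ℤ E^{(D)}(ℚ) = 2`, `E(ℚ)[p] = 0`, `Ш(E/ℚ)[p] = 0`,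
`#Sel^(p)(E/ℚ) = p`, `Ш(E^{(D)}/ℚ)[p] = 0`, `#Sel^(p)(E^{(D)}/ℚ) = p²`. CONDITIONAL on (γ) and the bit;
per-curve; BSD is not proved by it.

| curve | `Δ` | `p` (`a_p`) | `d_K` | `ℓ` (`a_ℓ`) | twist model | `P₁`, `P₂` on the twist model |
|---|---|---|---|---|---|---|
| `53a1` = `[1,-1,1,0,0]` | `-53` | `7` (`-4`) | `-47` | `167` (`21`) | `[0,141,0,17672,-1661168]` | `(376, -8836)`, `(7003, -592012)` |
| `53a1` = `[1,-1,1,0,0]` | `-53` | `7` (`-4`) | `-59` | `587` (`28`) | `[0,177,0,27848,-3286064]` | `(4484, -306328)`, `(1003, -34810)` |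

References: [Kolyvagin1991MathAnn] Thm. 2.3; [GrossLMS1991] Prop. 3.7 (2), §5 (5.1), Prop. 6.2 (1);
[McCallumLMS1991] §§2–5; [Serre1972] §5.4 Prop. 21; [Mazur1978] §6 Prop. 6.3 (1);
[CremonaAlgorithms1997] Table 1, §2.4, §3.5; [SilvermanAEC2009] III.2.3, VII.3.1(b), VII.3.4, VIII.6.7,
X.5 Cor. 5.4; [Marcus1977] Ch. 3 Thm. 25; [JetchevLauterStein2009] §3.6 (arXiv:0707.0032).
-/

set_option linter.dupNamespace false

noncomputable section

open scoped Classical NumberField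

namespace Summit.BirchSwinnertonDyer.BirchSwinnertonDyer.Theorems.KolyvaginDepthDoor

open Literature.NumberTheory.EllipticCurves Literature.NumberTheory.EllipticCurves.ModularForms
  WeierstrassCurve
open Summit.BirchSwinnertonDyer.BirchSwinnertonDyer.Rank2Observatory
open Summit.BirchSwinnertonDyer.BirchSwinnertonDyer.Rank1Residual
open Summit.BirchSwinnertonDyer.Rank1Residual.Additive

namespace SecondSign

/-! ## Curve `53a1` = `[1,-1,1,0,0]` (`Δ = -53`), rank one -/

namespace C53a1

/-- `53a1` = `[1,-1,1,0,0]` is an elliptic curve over `ℚ` (`Δ = -53 ≠ 0`, kernel-checked).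
[cite: CremonaAlgorithms1997, Table 1 (53a1)] -/
theorem isElliptic : ((⟨1, -1, 1, 0, 0⟩ : WeierstrassCurve ℤ).map (Int.castRingHom ℚ)).IsElliptic := by
  rw [WeierstrassCurve.isElliptic_iff, WeierstrassCurve.map_Δ, isUnit_iff_ne_zero, eq_intCast,
    Int.cast_ne_zero]
  decide +kernel

/-- **`53a1` = `[1,-1,1,0,0]` is a global minimal equation over `ℚ`** (`|Δ| = 53 < 3¹²`, `2¹² ∤ Δ`;
`isGloballyMinimal_map_int_of_natAbs_Δ_lt`, kernel-checked). [cite: CremonaAlgorithms1997, Table 1 (53a1)]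
[cite: SilvermanAEC2009, VII.1 Remark 1.1 and VIII.8] -/
theorem isGloballyMinimal : ((⟨1, -1, 1, 0, 0⟩ : WeierstrassCurve ℤ).map (Int.castRingHom ℚ)).IsGloballyMinimal :=
  isGloballyMinimal_map_int_of_natAbs_Δ_lt _ (by decide +kernel) (by decide +kernel) (by decide +kernel)

/-- The integral model of `53a1` is `[1,-1,1,0,0]`. [cite: CremonaAlgorithms1997, Table 1 (53a1)] -/
theorem intModel :
    haveI := isGloballyMinimal;
    integralModelInt ((⟨1, -1, 1, 0, 0⟩ : WeierstrassCurve ℤ).map (Int.castRingHom ℚ)) = ⟨1, -1, 1, 0, 0⟩ := by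
  haveI := isGloballyMinimal
  exact IntModel.integralModelInt_eq_of_map_eq _ rfl

/-- `#Ẽ(𝔽_7) = 12`, `a_7 = -4` for `53a1`, kernel-decided (`ℕ`-arithmetic Euler count
`PointCountNat.natCard_point_map_eq`). [cite: CremonaAlgorithms1997, Table 1 (53a1) and §2.4] -/
theorem card_7 :
    Nat.card (((⟨1, -1, 1, 0, 0⟩ : WeierstrassCurve ℤ).map (Int.castRingHom (ZMod 7))).toAffine.Point) = 12 := by
  rw [PointCountNat.natCard_point_map_eq (hℓ := ⟨by norm_num⟩) (by norm_num) 1 (-1) 1 0 0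
    (by decide +kernel)]
  decide +kernel

/-- `#Ẽ(𝔽_11) = 12`, `a_11 = 0` for `53a1`, kernel-decided (`ℕ`-arithmetic Euler count
`PointCountNat.natCard_point_map_eq`). [cite: CremonaAlgorithms1997, Table 1 (53a1) and §2.4] -/
theorem card_11 :
    Nat.card (((⟨1, -1, 1, 0, 0⟩ : WeierstrassCurve ℤ).map (Int.castRingHom (ZMod 11))).toAffine.Point) = 12 := by
  rw [PointCountNat.natCard_point_map_eq (hℓ := ⟨by norm_num⟩) (by norm_num) 1 (-1) 1 0 0
    (by decide +kernel)]
  decide +kernel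

/-- `#Ẽ(𝔽_167) = 147`, `a_167 = 21` for `53a1`, kernel-decided (`ℕ`-arithmetic Euler count
`PointCountNat.natCard_point_map_eq`). [cite: CremonaAlgorithms1997, Table 1 (53a1) and §2.4] -/
theorem card_167 :
    Nat.card (((⟨1, -1, 1, 0, 0⟩ : WeierstrassCurve ℤ).map (Int.castRingHom (ZMod 167))).toAffine.Point) = 147 := by
  rw [PointCountNat.natCard_point_map_eq (hℓ := ⟨by norm_num⟩) (by norm_num) 1 (-1) 1 0 0
    (by decide +kernel)]
  decide +kernel

/-- `#Ẽ(𝔽_587) = 560`, `a_587 = 28` for `53a1`, kernel-decided (`ℕ`-arithmetic Euler count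
`PointCountNat.natCard_point_map_eq`). [cite: CremonaAlgorithms1997, Table 1 (53a1) and §2.4] -/
theorem card_587 :
    Nat.card (((⟨1, -1, 1, 0, 0⟩ : WeierstrassCurve ℤ).map (Int.castRingHom (ZMod 587))).toAffine.Point) = 560 := by
  rw [PointCountNat.natCard_point_map_eq (hℓ := ⟨by norm_num⟩) (by norm_num) 1 (-1) 1 0 0
    (by decide +kernel)]
  decide +kernel

/-- **`7 ∈ B(53a1)`: `ρ̄_{E,7^m}` is onto for every `m`** (unconditional): semistable
(`gcd(c₄, Δ) = 1`), `X² − a_11 X + 11` with `a_11 = 0` root-free mod `7` (`E[7]` irreducible, Mazur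
6.3; onto, Serre Prop. 21), and the multiplicative prime `53` with `53^1 ∥ Δ`, `7 ∤ 1` (a transvection
lifts the image to `GL₂(ℤ/7^m)`; `hasSurjectiveModNGaloisRep_pow_of_intModel_certificate`).
[cite: Serre1972, §5.4 Prop. 21] [cite: Mazur1978, §6 Prop. 6.3 (1)] [cite: SerreAbelianLadic1968, Ch. IV §3.4] -/
theorem hasSurjectiveModNGaloisRep_pow_7 (m : ℕ) :
    ((⟨1, -1, 1, 0, 0⟩ : WeierstrassCurve ℤ).map (Int.castRingHom ℚ)).HasSurjectiveModNGaloisRep (7 ^ m : ℕ) := by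
  have hn : ∀ t : ZMod 7, t ^ 2 - (((11 : ℕ) : ℤ) + 1 - (12 : ℕ) : ℤ) * t + ((11 : ℕ) : ZMod 7) ≠ 0 := by
    decide +kernel
  haveI := Fact.mk (by norm_num : Nat.Prime 7)
  haveI := Fact.mk (by norm_num : Nat.Prime 11)
  haveI := isElliptic
  haveI := isGloballyMinimal
  exact hasSurjectiveModNGaloisRep_pow_of_intModel_certificate intModel
    (by rw [Int.isCoprime_iff_gcd_eq_one]; decide +kernel) 7 11 (by norm_num) (by decide +kernel)
    (n := 12) card_11 hn 53 (by norm_num) (by norm_num) (by decide +kernel) (by decide +kernel)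
    (e := 1) (by decide +kernel) (by decide +kernel) (by decide +kernel) m

/-- **`7` is a prime of good ordinary reduction for `53a1`** (`7 ∤ Δ`, `a_7 = -4`) — the crux's
conditions on the witness prime. [cite: CremonaAlgorithms1997, Table 1 (53a1)] -/
theorem goodOrdinary_7 :
    haveI := Fact.mk (by norm_num : Nat.Prime 7);
    haveI := isGloballyMinimal;
    ((⟨1, -1, 1, 0, 0⟩ : WeierstrassCurve ℤ).map (Int.castRingHom ℚ)).HasGoodReductionAtPrime 7 ∧ ¬ ((7 : ℕ) : ℤ) ∣ ((⟨1, -1, 1, 0, 0⟩ : WeierstrassCurve ℤ).map (Int.castRingHom ℚ)).frobeniusTrace 7 := by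
  haveI := Fact.mk (by norm_num : Nat.Prime 7)
  haveI := isGloballyMinimal
  exact goodOrdinary_of_intModel_certificate intModel 7 (by decide +kernel) (n := 12) card_7
    (by decide +kernel)

/-- **`53a1` is not CM** (unconditional): multiplicative reduction at `53` (`53 ∣ Δ = -53`,
`53 ∤ c₄ = -15`), while a CM curve over `ℚ` has no multiplicative prime (integral `j`).
[cite: SilvermanATAEC1994, Thm. II.6.4 (PDF p. 148)] [cite: CremonaAlgorithms1997, Table 1 (53a1)] -/
theorem not_hasCM :
    haveI := isElliptic;
    ¬ ((⟨1, -1, 1, 0, 0⟩ : WeierstrassCurve ℤ).map (Int.castRingHom ℚ)).HasCM := by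
  haveI := isElliptic
  haveI := isGloballyMinimal
  haveI := Fact.mk (by norm_num : Nat.Prime 53)
  intro hCM
  exact not_hasMultiplicativeReductionAtPrime_of_hasCM _ hCM 53
    (IntModel.hasMultiplicativeReductionAtPrime_of_intModel intModel 53 (by decide +kernel)
      (by decide +kernel))

/-- **`1 ≤ rank_ℤ E(ℚ)` for `53a1` IN THE KERNEL** — kind-`NL` certificate: the rational point
`6·(0, 0) = (9/25, -8/125)` has `5 ∣ den(x)`, hence infinite order (AEC VII.3.4; tree
`one_le_mordellWeilRank_of_dvd_den`). [cite: SilvermanAEC2009, VII.3.4 and Thm. VIII.6.7]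
[cite: CremonaAlgorithms1997, Table 1 (53a1)] -/
theorem one_le_rank : 1 ≤ ((⟨1, -1, 1, 0, 0⟩ : WeierstrassCurve ℤ).map (Int.castRingHom ℚ)).mordellWeilRank := by
  haveI := isElliptic
  haveI := isGloballyMinimal
  haveI : Fact (Nat.Prime 5) := ⟨by norm_num⟩
  have hP : ((⟨1, -1, 1, 0, 0⟩ : WeierstrassCurve ℤ).map (Int.castRingHom ℚ)).toAffine.Nonsingular ((9 : ℚ) / 25) ((-8 : ℚ) / 125) :=
    WeierstrassCurve.Affine.equation_iff_nonsingular.mp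
      ((WeierstrassCurve.Affine.equation_iff _ _).mpr (by norm_num [WeierstrassCurve.map]))
  exact one_le_mordellWeilRank_of_dvd_den _ 5 (by norm_num) hP (by decide +kernel)


/-! ### Row `53a1`, `(p, d_K, ℓ) = (7, -47, 167)`: the twist `E^{(-47)}` has rank two -/

/-- **Heegner data `d_K = -47` for `53a1`**: every prime of `Δ = -53` (hence of `N_E`) splits in a
quadratic field of discriminant `-47` (Kronecker symbols `= 1`). [cite: Marcus1977, Ch. 3 Thm. 25]
[cite: GrossLMS1991, §1] -/
theorem heegner_neg47 : ∀ q : ℕ, q.Prime → (q : ℤ) ∣ (⟨1, -1, 1, 0, 0⟩ : WeierstrassCurve ℤ).Δ →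
    (q = 2 → (-47 : ℤ) % 8 = 1) ∧ (q ≠ 2 → jacobiSym (-47) q = 1) :=
  forall_prime_dvd_of_natAbs_eq_pow (a := 53) (i := 1) (by decide +kernel) (by norm_num)
    ⟨by norm_num, by norm_num⟩

/-- The twist model of the kit `…RowKitSecondSign` for `(53a1, D = -47)`:
`[0, D b₂, 0, 8 D² b₄, 16 D³ b₆] = ⟨0, 141, 0, 17672, -1661168⟩` (`ℚ`-isomorphic to `E^{(-47)}`, `u = 1/2`).
[cite: SilvermanAEC2009, X.5 Cor. 5.4] -/
theorem twistModel_neg47 :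
    (⟨0, (-47) * (⟨1, -1, 1, 0, 0⟩ : WeierstrassCurve ℤ).b₂, 0, 8 * (-47) ^ 2 * (⟨1, -1, 1, 0, 0⟩ : WeierstrassCurve ℤ).b₄, 16 * (-47) ^ 3 * (⟨1, -1, 1, 0, 0⟩ : WeierstrassCurve ℤ).b₆⟩ : WeierstrassCurve ℤ) =
      ⟨0, 141, 0, 17672, -1661168⟩ := by
  ext <;> decide +kernel

/-- Killers for the twist model `⟨0, 141, 0, 17672, -1661168⟩` of `E^{(-47)}` from the kernel counts
`(q, #Ṽ(𝔽_q)) ∈ [(3, 7), (13, 11)]`. [cite: SilvermanAEC2009, Prop. VII.3.1(b)] -/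
theorem killers_neg47 : ∀ ℓN ∈ [((3 : ℕ), (7 : ℕ)), (13, 11)], ℓN.1.Prime ∧
    ∀ (x : ((⟨0, 141, 0, 17672, -1661168⟩ : WeierstrassCurve ℤ).map (Int.castRingHom ℚ)).toAffine.Point)
      (n : ℕ), ¬ ℓN.1 ∣ n → n • x = 0 → ℓN.2 • x = 0 :=
  killers_cons _ (q := 3) (N := 7) (by decide +kernel) (by decide +kernel)
    (killers_cons _ (q := 13) (N := 11) (by decide +kernel) (by decide +kernel)
    (killers_nil _))

/-- **`2 ≤ rank_ℤ E^{(-47)}(ℚ)` for `E = 53a1` IN THE KERNEL**, on the twist model `⟨0, 141, 0, 17672, -1661168⟩`: rational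
kernel certificate `Rank2Observatory.two_le_mordellWeilRank_of_ratCert` with the points
`P₁ = (376, -8836)`, `P₂ = (7003, -592012)` (found by a naive search on `d·η² = f(x)`), their chord
`P₁ + P₂ = (224, -4540)`, odd torsion annihilator `t = 1` from the counts at `q = 3, 13`, and doubling
witnesses at `q = 5, 7, 5` (residues `(1,4)`, `(3,6)`, `(4,0)`). Hence `P₁, P₂` are
`ℤ`-independent. [cite: SilvermanAEC2009, III.2.3, Prop. VII.3.1(b) and Thm. VIII.6.7]
[cite: CremonaAlgorithms1997, §3.5] -/
theorem two_le_rank_twist_neg47 :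
    2 ≤ ((⟨0, 141, 0, 17672, -1661168⟩ : WeierstrassCurve ℤ).map (Int.castRingHom ℚ)).mordellWeilRank :=
  two_le_mordellWeilRank_of_ratCert _ (x₁ := 376) (y₁ := -8836) (x₂ := 7003) (y₂ := -592012)
    (x₃ := 224) (y₃ := -4540) (by decide +kernel) (by decide +kernel)
    (by decide +kernel) (by decide +kernel) (t := 1) (by decide) killers_neg47 (by decide +kernel)
    5 7 5 (by decide +kernel) (by decide +kernel) (by decide +kernel) (by decide +kernel)
    (by decide +kernel) (by decide +kernel) 1 4 3 6 4 0 (by decide +kernel)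
    (by decide +kernel) (by decide +kernel) (by decide +kernel) (by decide +kernel)
    (by decide +kernel)

/-- **SECOND-SIGN DEPTH-TABLE ROW `53a1`, `(p, d_K, ℓ) = (7, -47, 167)`, ON PRINT-STANDARD INPUTS.**
For `E = 53a1` (rank one), ANY imaginary quadratic `K` with `d_K = -47` (Heegner for `N_E`; the twist
`E^{(-47)}` has two independent rational points, certified in the kernel), any frame `(Dt, β, ι)` and
ANY single Kolyvagin–Heegner datum `d` of conductor `167` (a Kolyvagin prime: `(-47/167) = −1`,
`7 ∣ 167 + 1`, `7 ∣ a_167 = 21`), granted the ONE Literature fact (γ) =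
`GrossLMS1991.prop37_2_frobeniusCongruence` (Gross 1991 Prop. 3.7 (2); cite-only): IF
`d.kolyvaginClass _ 1 ≠ 0` (the row's bit), THEN `corank_{ℤ_7} Ш(E)[7^∞] = 0`, `rank_ℤ E(ℚ) = 1`,
`corank_{ℤ_7} Ш(E^{(-47)})[7^∞] = 0`, `rank_ℤ E^{(-47)}(ℚ) = 2`, `E(ℚ)[7] = 0`, `Ш(E/ℚ)[7] = 0`,
`#Sel^(7)(E/ℚ) = 7`, `Ш(E^{(-47)}/ℚ)[7] = 0` and `#Sel^(7)(E^{(-47)}/ℚ) = 7²` — the crux's SECOND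
rank clause `ν = rank E(ℚ) = rank E^{(d_K)}(ℚ) − 1` at this curve, and `Ш[7] = 0` for the RANK-TWO
curve `E^{(-47)}` (conductor `N_E·47²`), which no first-sign row reaches through `K`. Side conditions:
`ρ̄_{E,7^m}` onto (`hasSurjectiveModNGaloisRep_pow_7`), non-CM, Heegner, Kolyvagin prime
(`card_167`), (KN_7) from `Δ(E₀) = -53` (`decide`-able table), `1 ≤ rank` (`one_le_rank`),
`2 ≤ rank E^{(-47)}` (`two_le_rank_twist_neg47`) — all kernel theorems. CONDITIONAL on (γ) and the
bit; per-curve; BSD is not proved by it. [cite: Kolyvagin1991MathAnn, Thm. 2.3]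
[cite: GrossLMS1991, Prop. 3.7 (2), §5 (5.1), Prop. 6.2 (1)] [cite: McCallumLMS1991, §§2–5]
[cite: JetchevLauterStein2009, §3.6 (arXiv:0707.0032)] -/
theorem depthRow_7_neg47_167_secondSign
    (h372 : GrossLMS1991.prop37_2_frobeniusCongruence)
    (K : Type) [Field K] [NumberField K] (hK : IsImaginaryQuadratic K)
    (hD : NumberField.discr K = -47) :
    haveI := isElliptic;
    haveI := isGloballyMinimal;
    haveI : NeZero (((⟨1, -1, 1, 0, 0⟩ : WeierstrassCurve ℤ).map (Int.castRingHom ℚ)).conductorNorm ℤ) := neZero_conductorNorm_of_isElliptic _;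
    ∀ (Dt : ModularParametrizationData ((⟨1, -1, 1, 0, 0⟩ : WeierstrassCurve ℤ).map (Int.castRingHom ℚ)) (((⟨1, -1, 1, 0, 0⟩ : WeierstrassCurve ℤ).map (Int.castRingHom ℚ)).conductorNorm ℤ)) (β : ℤ) (ι : K →+* ℂ)
      (d : KolyvaginHeegnerData Dt β ι 167),
    d.kolyvaginClass (p := 7) (by norm_num) 1 ≠ 0 →
    ((⟨1, -1, 1, 0, 0⟩ : WeierstrassCurve ℤ).map (Int.castRingHom ℚ)).shaCorank 7 = 0 ∧ ((⟨1, -1, 1, 0, 0⟩ : WeierstrassCurve ℤ).map (Int.castRingHom ℚ)).mordellWeilRank = 1 ∧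
      (((⟨1, -1, 1, 0, 0⟩ : WeierstrassCurve ℤ).map (Int.castRingHom ℚ)).quadraticTwist ((-47 : ℤ) : ℚ)).shaCorank 7 = 0 ∧
      (((⟨1, -1, 1, 0, 0⟩ : WeierstrassCurve ℤ).map (Int.castRingHom ℚ)).quadraticTwist ((-47 : ℤ) : ℚ)).mordellWeilRank = 2 ∧
      (∀ P : ((⟨1, -1, 1, 0, 0⟩ : WeierstrassCurve ℤ).map (Int.castRingHom ℚ)).toAffine.Point, 7 • P = 0 → P = 0) ∧
      (∀ x ∈ ((⟨1, -1, 1, 0, 0⟩ : WeierstrassCurve ℤ).map (Int.castRingHom ℚ)).sha, 7 • x = 0 → x = 0) ∧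
      Nat.card ↥(selmerGroup ((⟨1, -1, 1, 0, 0⟩ : WeierstrassCurve ℤ).map (Int.castRingHom ℚ)) ((7 : ℕ) : ℤ)) = 7 ∧
      (∀ x ∈ (((⟨1, -1, 1, 0, 0⟩ : WeierstrassCurve ℤ).map (Int.castRingHom ℚ)).quadraticTwist ((-47 : ℤ) : ℚ)).sha, 7 • x = 0 → x = 0) ∧
      Nat.card ↥(selmerGroup (((⟨1, -1, 1, 0, 0⟩ : WeierstrassCurve ℤ).map (Int.castRingHom ℚ)).quadraticTwist ((-47 : ℤ) : ℚ)) ((7 : ℕ) : ℤ)) = 7 ^ 2 := by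
  haveI := isElliptic
  haveI := isGloballyMinimal
  haveI : NeZero (((⟨1, -1, 1, 0, 0⟩ : WeierstrassCurve ℤ).map (Int.castRingHom ℚ)).conductorNorm ℤ) := neZero_conductorNorm_of_isElliptic _
  intro Dt β ι d hne
  haveI := Fact.mk (by norm_num : Nat.Prime 7)
  exact depthRowSecondSign_print_of_datum_of_intModel_certificate intModel h372 not_hasCM one_le_rank
    7 (by norm_num) hasSurjectiveModNGaloisRep_pow_7 K hK hD (by norm_num) (by norm_num)
    twistModel_neg47 two_le_rank_twist_neg47 heegner_neg47 167 (by norm_num) (by norm_num)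
    (by decide +kernel) (by norm_num) (by norm_num) (by norm_num) (by norm_num) (n := 147) card_167
    (by norm_num) (Δ₀ := -53) (by decide +kernel) (B := 11) (by decide +kernel) (by decide +kernel)
    (fun _ _ ↦ Or.inl (by norm_num)) Dt β ι d hne


/-! ### Row `53a1`, `(p, d_K, ℓ) = (7, -59, 587)`: the twist `E^{(-59)}` has rank two -/

/-- **Heegner data `d_K = -59` for `53a1`**: every prime of `Δ = -53` (hence of `N_E`) splits in a
quadratic field of discriminant `-59` (Kronecker symbols `= 1`). [cite: Marcus1977, Ch. 3 Thm. 25]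
[cite: GrossLMS1991, §1] -/
theorem heegner_neg59 : ∀ q : ℕ, q.Prime → (q : ℤ) ∣ (⟨1, -1, 1, 0, 0⟩ : WeierstrassCurve ℤ).Δ →
    (q = 2 → (-59 : ℤ) % 8 = 1) ∧ (q ≠ 2 → jacobiSym (-59) q = 1) :=
  forall_prime_dvd_of_natAbs_eq_pow (a := 53) (i := 1) (by decide +kernel) (by norm_num)
    ⟨by norm_num, by norm_num⟩

/-- The twist model of the kit `…RowKitSecondSign` for `(53a1, D = -59)`:
`[0, D b₂, 0, 8 D² b₄, 16 D³ b₆] = ⟨0, 177, 0, 27848, -3286064⟩` (`ℚ`-isomorphic to `E^{(-59)}`, `u = 1/2`).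
[cite: SilvermanAEC2009, X.5 Cor. 5.4] -/
theorem twistModel_neg59 :
    (⟨0, (-59) * (⟨1, -1, 1, 0, 0⟩ : WeierstrassCurve ℤ).b₂, 0, 8 * (-59) ^ 2 * (⟨1, -1, 1, 0, 0⟩ : WeierstrassCurve ℤ).b₄, 16 * (-59) ^ 3 * (⟨1, -1, 1, 0, 0⟩ : WeierstrassCurve ℤ).b₆⟩ : WeierstrassCurve ℤ) =
      ⟨0, 177, 0, 27848, -3286064⟩ := by
  ext <;> decide +kernel

/-- Killers for the twist model `⟨0, 177, 0, 27848, -3286064⟩` of `E^{(-59)}` from the kernel counts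
`(q, #Ṽ(𝔽_q)) ∈ [(3, 7), (13, 11)]`. [cite: SilvermanAEC2009, Prop. VII.3.1(b)] -/
theorem killers_neg59 : ∀ ℓN ∈ [((3 : ℕ), (7 : ℕ)), (13, 11)], ℓN.1.Prime ∧
    ∀ (x : ((⟨0, 177, 0, 27848, -3286064⟩ : WeierstrassCurve ℤ).map (Int.castRingHom ℚ)).toAffine.Point)
      (n : ℕ), ¬ ℓN.1 ∣ n → n • x = 0 → ℓN.2 • x = 0 :=
  killers_cons _ (q := 3) (N := 7) (by decide +kernel) (by decide +kernel)
    (killers_cons _ (q := 13) (N := 11) (by decide +kernel) (by decide +kernel)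
    (killers_nil _))

/-- **`2 ≤ rank_ℤ E^{(-59)}(ℚ)` for `E = 53a1` IN THE KERNEL**, on the twist model `⟨0, 177, 0, 27848, -3286064⟩`: rational
kernel certificate `Rank2Observatory.two_le_mordellWeilRank_of_ratCert` with the points
`P₁ = (4484, -306328)`, `P₂ = (1003, -34810)` (found by a naive search on `d·η² = f(x)`), their chord
`P₁ + P₂ = (420, -10664)`, odd torsion annihilator `t = 1` from the counts at `q = 3, 13`, and doubling
witnesses at `q = 7, 5, 5` (residues `(4,6)`, `(3,0)`, `(0,1)`). Hence `P₁, P₂` are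
`ℤ`-independent. [cite: SilvermanAEC2009, III.2.3, Prop. VII.3.1(b) and Thm. VIII.6.7]
[cite: CremonaAlgorithms1997, §3.5] -/
theorem two_le_rank_twist_neg59 :
    2 ≤ ((⟨0, 177, 0, 27848, -3286064⟩ : WeierstrassCurve ℤ).map (Int.castRingHom ℚ)).mordellWeilRank :=
  two_le_mordellWeilRank_of_ratCert _ (x₁ := 4484) (y₁ := -306328) (x₂ := 1003) (y₂ := -34810)
    (x₃ := 420) (y₃ := -10664) (by decide +kernel) (by decide +kernel)
    (by decide +kernel) (by decide +kernel) (t := 1) (by decide) killers_neg59 (by decide +kernel)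
    7 5 5 (by decide +kernel) (by decide +kernel) (by decide +kernel) (by decide +kernel)
    (by decide +kernel) (by decide +kernel) 4 6 3 0 0 1 (by decide +kernel)
    (by decide +kernel) (by decide +kernel) (by decide +kernel) (by decide +kernel)
    (by decide +kernel)

/-- **SECOND-SIGN DEPTH-TABLE ROW `53a1`, `(p, d_K, ℓ) = (7, -59, 587)`, ON PRINT-STANDARD INPUTS.**
For `E = 53a1` (rank one), ANY imaginary quadratic `K` with `d_K = -59` (Heegner for `N_E`; the twist
`E^{(-59)}` has two independent rational points, certified in the kernel), any frame `(Dt, β, ι)` and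
ANY single Kolyvagin–Heegner datum `d` of conductor `587` (a Kolyvagin prime: `(-59/587) = −1`,
`7 ∣ 587 + 1`, `7 ∣ a_587 = 28`), granted the ONE Literature fact (γ) =
`GrossLMS1991.prop37_2_frobeniusCongruence` (Gross 1991 Prop. 3.7 (2); cite-only): IF
`d.kolyvaginClass _ 1 ≠ 0` (the row's bit), THEN `corank_{ℤ_7} Ш(E)[7^∞] = 0`, `rank_ℤ E(ℚ) = 1`,
`corank_{ℤ_7} Ш(E^{(-59)})[7^∞] = 0`, `rank_ℤ E^{(-59)}(ℚ) = 2`, `E(ℚ)[7] = 0`, `Ш(E/ℚ)[7] = 0`,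
`#Sel^(7)(E/ℚ) = 7`, `Ш(E^{(-59)}/ℚ)[7] = 0` and `#Sel^(7)(E^{(-59)}/ℚ) = 7²` — the crux's SECOND
rank clause `ν = rank E(ℚ) = rank E^{(d_K)}(ℚ) − 1` at this curve, and `Ш[7] = 0` for the RANK-TWO
curve `E^{(-59)}` (conductor `N_E·59²`), which no first-sign row reaches through `K`. Side conditions:
`ρ̄_{E,7^m}` onto (`hasSurjectiveModNGaloisRep_pow_7`), non-CM, Heegner, Kolyvagin prime
(`card_587`), (KN_7) from `Δ(E₀) = -53` (`decide`-able table), `1 ≤ rank` (`one_le_rank`),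
`2 ≤ rank E^{(-59)}` (`two_le_rank_twist_neg59`) — all kernel theorems. CONDITIONAL on (γ) and the
bit; per-curve; BSD is not proved by it. [cite: Kolyvagin1991MathAnn, Thm. 2.3]
[cite: GrossLMS1991, Prop. 3.7 (2), §5 (5.1), Prop. 6.2 (1)] [cite: McCallumLMS1991, §§2–5]
[cite: JetchevLauterStein2009, §3.6 (arXiv:0707.0032)] -/
theorem depthRow_7_neg59_587_secondSign
    (h372 : GrossLMS1991.prop37_2_frobeniusCongruence)
    (K : Type) [Field K] [NumberField K] (hK : IsImaginaryQuadratic K)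
    (hD : NumberField.discr K = -59) :
    haveI := isElliptic;
    haveI := isGloballyMinimal;
    haveI : NeZero (((⟨1, -1, 1, 0, 0⟩ : WeierstrassCurve ℤ).map (Int.castRingHom ℚ)).conductorNorm ℤ) := neZero_conductorNorm_of_isElliptic _;
    ∀ (Dt : ModularParametrizationData ((⟨1, -1, 1, 0, 0⟩ : WeierstrassCurve ℤ).map (Int.castRingHom ℚ)) (((⟨1, -1, 1, 0, 0⟩ : WeierstrassCurve ℤ).map (Int.castRingHom ℚ)).conductorNorm ℤ)) (β : ℤ) (ι : K →+* ℂ)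
      (d : KolyvaginHeegnerData Dt β ι 587),
    d.kolyvaginClass (p := 7) (by norm_num) 1 ≠ 0 →
    ((⟨1, -1, 1, 0, 0⟩ : WeierstrassCurve ℤ).map (Int.castRingHom ℚ)).shaCorank 7 = 0 ∧ ((⟨1, -1, 1, 0, 0⟩ : WeierstrassCurve ℤ).map (Int.castRingHom ℚ)).mordellWeilRank = 1 ∧
      (((⟨1, -1, 1, 0, 0⟩ : WeierstrassCurve ℤ).map (Int.castRingHom ℚ)).quadraticTwist ((-59 : ℤ) : ℚ)).shaCorank 7 = 0 ∧
      (((⟨1, -1, 1, 0, 0⟩ : WeierstrassCurve ℤ).map (Int.castRingHom ℚ)).quadraticTwist ((-59 : ℤ) : ℚ)).mordellWeilRank = 2 ∧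
      (∀ P : ((⟨1, -1, 1, 0, 0⟩ : WeierstrassCurve ℤ).map (Int.castRingHom ℚ)).toAffine.Point, 7 • P = 0 → P = 0) ∧
      (∀ x ∈ ((⟨1, -1, 1, 0, 0⟩ : WeierstrassCurve ℤ).map (Int.castRingHom ℚ)).sha, 7 • x = 0 → x = 0) ∧
      Nat.card ↥(selmerGroup ((⟨1, -1, 1, 0, 0⟩ : WeierstrassCurve ℤ).map (Int.castRingHom ℚ)) ((7 : ℕ) : ℤ)) = 7 ∧
      (∀ x ∈ (((⟨1, -1, 1, 0, 0⟩ : WeierstrassCurve ℤ).map (Int.castRingHom ℚ)).quadraticTwist ((-59 : ℤ) : ℚ)).sha, 7 • x = 0 → x = 0) ∧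
      Nat.card ↥(selmerGroup (((⟨1, -1, 1, 0, 0⟩ : WeierstrassCurve ℤ).map (Int.castRingHom ℚ)).quadraticTwist ((-59 : ℤ) : ℚ)) ((7 : ℕ) : ℤ)) = 7 ^ 2 := by
  haveI := isElliptic
  haveI := isGloballyMinimal
  haveI : NeZero (((⟨1, -1, 1, 0, 0⟩ : WeierstrassCurve ℤ).map (Int.castRingHom ℚ)).conductorNorm ℤ) := neZero_conductorNorm_of_isElliptic _
  intro Dt β ι d hne
  haveI := Fact.mk (by norm_num : Nat.Prime 7)
  exact depthRowSecondSign_print_of_datum_of_intModel_certificate intModel h372 not_hasCM one_le_rank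
    7 (by norm_num) hasSurjectiveModNGaloisRep_pow_7 K hK hD (by norm_num) (by norm_num)
    twistModel_neg59 two_le_rank_twist_neg59 heegner_neg59 587 (by norm_num) (by norm_num)
    (by decide +kernel) (by norm_num) (by norm_num) (by norm_num) (by norm_num) (n := 560) card_587
    (by norm_num) (Δ₀ := -53) (by decide +kernel) (B := 11) (by decide +kernel) (by decide +kernel)
    (fun _ _ ↦ Or.inl (by norm_num)) Dt β ι d hne

end C53a1


end SecondSign

end Summit.BirchSwinnertonDyer.BirchSwinnertonDyer.Theorems.KolyvaginDepthDoor

end
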